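import Summits.QuantumFields.YangMills.Theorems.HistoryWedgeHistoryTailOfWedge

/-!
# Crux `HistoryTailL` (stmt-QuantumFields-19936), LINE «history-wedge» (registered skeleton `Cruxes/HistoryTailL/Lines/history_wedge.lean`,
# ideator seat ym-r3-idea-2 g4): the registered stub `stub_historyTailOfWedge : HistoryTailOfWedge` LANDED

Seat `ym-line-sfw-p2-w2` g20 (width seat of cell `ym-idea-1`, free hands).  The stub is the support item `HistoryTailOfWedge`
(stmt-QuantumFields-27960) of route `HistoryWedge`, proved in `Theorems/HistoryWedgeHistoryTailOfWedge.lean`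
(`HistoryWedgeGlue.historyTailOfWedge_proof`: floor currency on the wedge + the landed bare tail + the wedge-restricted history reduction
`T3HistoryTailReduction.historyTailAt_of_heightTailOnWedge'`); this file states it under the registered NAME and SIGNATURE so that the
skeleton's composition `HistoryTailL_of := stub_historyTailOfWedge (WedgeTailL_of stub_shallowWedge stub_steepWedge)` reads it by name.
The two regime stubs `stub_shallowWedge` / `stub_steepWedge` (= crux `WedgeTailL`, stmt-QuantumFields-27959) stay OPEN; no summit, no rung
(`YM3TorusSU2`), no mass gap is proved by this.
-/

namespace Summit.QuantumFields.YangMills.Theorems.HistoryTailLHistoryWedge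

open Summit.QuantumFields.YangMills.Theses.HistoryWedge (WedgeTailL HistoryTailOfWedge)

/-- The registered stub `stub_historyTailOfWedge` of LINE «history-wedge» on crux `HistoryTailL` (stmt-QuantumFields-19936): the glue item
`HistoryTailOfWedge` of route `HistoryWedge`, by `HistoryWedgeGlue.historyTailOfWedge_proof`. [cite: Balaban1985UV3, (7) p.257 and (71) p.273; King1986, (3.12) p.657] -/
theorem stub_historyTailOfWedge : HistoryTailOfWedge :=
  Summit.QuantumFields.YangMills.Theorems.HistoryWedgeGlue.historyTailOfWedge_proof

end Summit.QuantumFields.YangMills.Theorems.HistoryTailLHistoryWedge
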